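import Summits.Schanuel.Schanuel.Theorems.RootDecomp1BAlgFrame05

/-!
# RootDecomp1BAlgFrame — lens 4, generation 40 «UNBOUNDED-DEGREE FRAMES» (lane B-R24 (b′), PRICE B-β, RULE B-R26): X(2) and the three At-cells at (1 | ρ) for every ρ in the class `AlgUltraLiouville` (doubly-exponential hyper-approximation by real algebraic irrationals of UNBOUNDED degree) modulo `Roy2014_thm_1_1` ONLY — the degree a running parameter of Roy's point-explicit L–W measure (budget lemma `algFrameMeasure_explicit_of_roy` with the floor exp(−royC D·exp(A^8)·(1+log H)) in its TYPE); the NAMED MEMBER ρ_A (a tower over 2^{1/p}, prime degrees p → ∞) with HYPOTHESIS-FREE membership, degree certificate [ℚ(β_K):ℚ] = g_K, position certificate |ρ_A − γ| ≥ exp(−A⁴) and the exclusions BY TREE NAMES (¬Hyper, ¬QuadHyper, ¬Ultra ×2, ¬LiouvilleOrder 8, transcendental) — continuation (RootDecomp1BAlgFrame06): §M.6–§M.7 degree certificate + number-field Liouville inequality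

(lens-4 g40 HOME kernel AlgFrame.lean fe3f4606…, 1974 l, imports tree RootDecomp1BQuadFrame05 + RootDecomp1EPointTransfer04 only; CLAIM L2078, RULING + CHECKLIST B-g40 L2080, NODE L2101 / REQUEST L2102 / RESULT L2103, critic VERDICT L2111 (crit g9: (A) CLEARED — ONE CELL (B-β); lens-4 tally THEOREM ×6 + CELL ×3; RULE B-R26 in force (the Roy-transfer line on 1B CLOSED); PORT GO 01–09 `--supports stmt-Schanuel-24622`); port by census-1 gen 18 as `RootDecomp1BAlgFrame01`–`09` along K's sections: 01 = §D the class `AlgUltraLiouville` + the measure shape `AlgFrameMeasure` + §R helpers (`royC`); 02 = §R the budget lemma `algFrameMeasure_explicit_of_roy` (Roy ⟹ the algebraic frame measure in EVERY degree; scoped `maxHeartbeats 1600000` carried as in K); 03 = §E the engine `algebraicIndependent_exp_frame_of_algUltraLiouville (hRoy)` + the `![…]` forms; 04 = §M.1–§M.3 prime degrees `gdeg`, radicals `theta`, frame data `Nseq`/`Pseq`/`fd` (with `attribute [irreducible] fd`), `betaSeq`, `fSeq`, `ASeq`, growth; 05 = §M.4–§M.5 increments, the limit `rhoA`, MEMBERSHIP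 `algUltraLiouville_rhoA`; 06 = §M.6–§M.7 degree certificate `finrank_adjoin_theta` / `adjoin_betaSeq_eq` + the number-field Liouville inequality (`FK`, `thetaF`, `sigma0`, norm to ℚ); 07 = §M.8–§M.9 the frame bound, the tower inequality, scale selection, `cert_arith`; 08 = §M.10–§M.11 THE POSITION CERTIFICATE `rhoA_far_from_degree_le` + EXCLUSIONS by tree names (`not_hyperLiouville_rhoA`, `not_quadHyperLiouville_rhoA`, `not_ultraLiouville_rhoA` / `'`, `not_liouvilleOrder_rhoA`, `transcendental_rhoA`); 09 = §C the cells `four_le_polarDeg_one_of_algUltra (hRoy)` (+ swap), the At-cells, the member cells at ρ_A, `rhoA_position`.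
PORT EDITS: the three `set_option linter.*` lines dropped and the one surfaced `unnecessarySimpa` fixed (`simpa using h12` ↦ `simp`, §R); 74 one-line docstrings added; two generic helpers made `private` (`three_mul_le_two_pow`, `half_identity`) with per-part private copies of those and of K's own private helpers; statements and proofs verbatim. `--supports stmt-Schanuel-24622`; no census credit carried; rung 0 — nothing here proves Schanuel.)
-/

noncomputable section

open Complex IntermediateField MvPolynomial

namespace Summit.Schanuel.Schanuel.Theorems.RootDecomp1BAlgFrame

open Summit.Schanuel.Schanuel.Theorems.RootDecomp1EPointTransfer (Roy2014_thm_1_1)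
open Summit.Schanuel.Schanuel.Theorems.RootDecomp1KHyper (mvlen mvlen_nonneg abs_coeff_le_mvlen one_le_mvlen)
open Summit.Schanuel.Schanuel.Theorems.RootDecomp1BHyperFrame (royDeg royS RoyNF roy_tree_iff framePt Ff
  Ff_eq_aeval exists_lipschitz_Ff linearIndependent_one_irrational)
open Summit.Schanuel.Schanuel.Theorems.RootDecomp1BQuadFrame (qy qe qpt qpt_apply framePt_qy_qe linearIndependent_qpt
  QuadHyperLiouville)
open Summit.Schanuel.Schanuel.Theorems.RootDecomp1BFedFlagCore (KleinIH polarDeg polarField)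
open Summit.Schanuel.Schanuel.Theorems.RootDecomp1BDefectFloorDefs (SharpRelativeLindemannAt TameDefectZeroAt
  WildSharpDefectZeroAt WildSharpDefectZeroInitAt WildSharpInitAt)
open Summit.Schanuel.Schanuel.Theorems.RootDecomp1BDefectFloorCells (natCast_le_trdeg_of_algebraicIndependent)
open Summit.Schanuel.Schanuel.Theorems.RootDecomp1BRadicalDescent (exists_int_relation)
open Summit.Schanuel.Schanuel.Theorems.RootDecomp1BMovingZero (mem_polarField_one mem_polarField_swap)

section Member

/-! ### §M.6 the exact degree `[ℚ(β_K) : ℚ] = g_K` — THE DEGREE CERTIFICATE -/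

/-- `2` is not a `p`-th power in `ℚ` for `p ≥ 2` (2-adic valuation). -/
theorem rat_pow_ne_two {p : ℕ} (hp : 2 ≤ p) (b : ℚ) : b ^ p ≠ 2 := by
  intro h
  haveI : Fact (Nat.Prime 2) := ⟨Nat.prime_two⟩
  have hv : padicValRat 2 (b ^ p) = padicValRat 2 ((2 : ℕ) : ℚ) := by rw [h]; norm_num
  rw [padicValRat.pow, padicValRat.self (by norm_num)] at hv
  have h1 : (p : ℤ) = 1 := Int.eq_one_of_mul_eq_one_right (by positivity) hv
  omega

/-- `X^{g_K} − 2` is irreducible over `ℚ` (Eisenstein at 2). -/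
theorem irreducible_X_pow_sub_two (K : ℕ) :
    Irreducible (Polynomial.X ^ gdeg K - Polynomial.C (2 : ℚ)) :=
  X_pow_sub_C_irreducible_of_prime (gdeg_prime K) fun b => rat_pow_ne_two (gdeg_prime K).two_le b

/-- `θ_K` is a root of `X^{g_K} − 2`. -/
theorem aeval_theta_X_pow_sub_two (K : ℕ) :
    Polynomial.aeval (theta K) (Polynomial.X ^ gdeg K - Polynomial.C (2 : ℚ)) = 0 := by
  simp [theta_pow]

/-- `θ_K` is integral over `ℚ`. -/
theorem theta_isIntegral (K : ℕ) : IsIntegral ℚ (theta K) := by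
  refine IsIntegral.of_pow (gdeg_pos K) ?_
  rw [theta_pow]
  have : IsIntegral ℚ ((algebraMap ℚ ℝ) 2) := isIntegral_algebraMap
  rwa [map_ofNat] at this

/-- `minpoly ℚ θ_K = X^{g_K} − 2`. -/
theorem minpoly_theta (K : ℕ) : minpoly ℚ (theta K) = Polynomial.X ^ gdeg K - Polynomial.C 2 :=
  (minpoly.eq_of_irreducible_of_monic (irreducible_X_pow_sub_two K) (aeval_theta_X_pow_sub_two K)
    (Polynomial.monic_X_pow_sub_C (2 : ℚ) (gdeg_ne_zero K))).symm

/-- `[ℚ(θ_K) : ℚ] = g_K` — the degree certificate. -/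
theorem finrank_adjoin_theta (K : ℕ) : Module.finrank ℚ ℚ⟮theta K⟯ = gdeg K := by
  rw [IntermediateField.adjoin.finrank (theta_isIntegral K), minpoly_theta,
    Polynomial.natDegree_X_pow_sub_C]

/-- `θ_K = a_K β_K − P_K`. -/
theorem theta_eq (K : ℕ) : theta K = (aN K : ℝ) * betaSeq K - Pseq K := by
  rw [aN_mul_betaSeq]; ring

/-- `ℚ(β_K) = ℚ(θ_K)`. -/
theorem adjoin_betaSeq_eq (K : ℕ) : ℚ⟮betaSeq K⟯ = ℚ⟮theta K⟯ := by
  refine le_antisymm (IntermediateField.adjoin_simple_le_iff.mpr ?_)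
    (IntermediateField.adjoin_simple_le_iff.mpr ?_)
  · rw [betaSeq_def]
    exact div_mem (add_mem (_root_.natCast_mem _ _) (IntermediateField.mem_adjoin_simple_self ℚ _))
      (_root_.natCast_mem _ _)
  · rw [theta_eq K]
    exact sub_mem (mul_mem (_root_.natCast_mem _ _) (IntermediateField.mem_adjoin_simple_self ℚ _))
      (_root_.natCast_mem _ _)

/-- A root of a non-zero integer polynomial generates an extension of degree `≤ natDegree`
(any field of characteristic zero). -/
theorem finrank_adjoin_root_le' {B : Type*} [Field B] [Algebra ℚ B] {f : Polynomial ℤ} (hf : f ≠ 0)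
    {z : B} (hz : Polynomial.aeval z f = 0) :
    IsIntegral ℚ z ∧ Module.finrank ℚ ℚ⟮z⟯ ≤ f.natDegree := by
  set p : Polynomial ℚ := f.map (Int.castRingHom ℚ) with hp
  have hp0 : p ≠ 0 := (Polynomial.map_ne_zero_iff (Int.castRingHom ℚ).injective_int).mpr hf
  have hpz : Polynomial.aeval z p = 0 := by rw [hp, aeval_map_int, hz]
  have halg : IsAlgebraic ℚ z := ⟨p, hp0, hpz⟩
  have hint : IsIntegral ℚ z := halg.isIntegral
  refine ⟨hint, ?_⟩
  rw [IntermediateField.adjoin.finrank hint]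
  have h1 := minpoly.degree_le_of_ne_zero ℚ z hp0 hpz
  have h2 : p.natDegree = f.natDegree := Polynomial.natDegree_map_eq_of_injective (Int.castRingHom ℚ).injective_int f
  rw [← h2]
  exact Polynomial.natDegree_le_natDegree h1

/-- **THE DEGREE CERTIFICATE.** No non-zero integer polynomial of degree `< g_K` vanishes at `β_K`. -/
theorem aeval_betaSeq_ne_zero {K : ℕ} {h : Polynomial ℤ} (hh : h ≠ 0) (hdeg : h.natDegree < gdeg K) :
    Polynomial.aeval (betaSeq K) h ≠ 0 := by
  intro hzero
  obtain ⟨-, hfin⟩ := finrank_adjoin_root_le' hh hzero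
  rw [adjoin_betaSeq_eq, finrank_adjoin_theta] at hfin
  omega

/-! ### §M.7 the Liouville inequality at `β_K` — norm from `ℚ(2^{1/g_K})` down to `ℚ` -/

/-- Ring homs commute with `aeval` of integer polynomials. -/
theorem ringHom_aeval_int {B B' : Type*} [CommRing B] [CommRing B'] (ψ : B →+* B') (x : B)
    (p : Polynomial ℤ) : ψ (Polynomial.aeval x p) = Polynomial.aeval (ψ x) p := by
  rw [Polynomial.aeval_def, Polynomial.aeval_def, Polynomial.hom_eval₂]
  congr 1
  exact RingHom.ext_int _ _

/-- `aeval` of an integer polynomial at an integral element is integral. -/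
theorem isIntegral_aeval_int {B : Type*} [CommRing B] {x : B} (hx : IsIntegral ℤ x) (p : Polynomial ℤ) :
    IsIntegral ℤ (Polynomial.aeval x p) := by
  rw [Polynomial.aeval_eq_sum_range]
  refine IsIntegral.sum _ fun i _ => ?_
  rw [Algebra.smul_def]
  exact isIntegral_algebraMap.mul (hx.pow i)

/-- Norm bound for `aeval` over `ℂ`: `‖p(z)‖ ≤ (d+1) · A · R^d` for `deg p ≤ d`, `|p_i| ≤ A`, `‖z‖ ≤ R`, `1 ≤ R`. -/
theorem norm_aeval_le {p : Polynomial ℤ} {d : ℕ} (hd : p.natDegree ≤ d) {A : ℕ} (hA : ∀ i, |p.coeff i| ≤ (A : ℤ))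
    {z : ℂ} {R : ℝ} (hR : 1 ≤ R) (hz : ‖z‖ ≤ R) :
    ‖Polynomial.aeval z p‖ ≤ (d + 1) * A * R ^ d := by
  rw [Polynomial.aeval_eq_sum_range' (Nat.lt_succ_of_le hd)]
  refine (norm_sum_le _ _).trans ?_
  have hterm : ∀ i ∈ Finset.range (d + 1), ‖p.coeff i • z ^ i‖ ≤ A * R ^ d := by
    intro i hi
    rw [Finset.mem_range] at hi
    rw [Algebra.smul_def, norm_mul, norm_pow, eq_intCast, Complex.norm_intCast]
    have h1 : (|(p.coeff i : ℝ)|) ≤ A := by exact_mod_cast hA i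
    have h2 : ‖z‖ ^ i ≤ R ^ d :=
      (pow_le_pow_left₀ (norm_nonneg _) hz i).trans (pow_le_pow_right₀ hR (by omega))
    exact mul_le_mul h1 h2 (by positivity) (by positivity)
  calc ∑ i ∈ Finset.range (d + 1), ‖p.coeff i • z ^ i‖ ≤ ∑ i ∈ Finset.range (d + 1), (A : ℝ) * R ^ d :=
        Finset.sum_le_sum hterm
    _ = (d + 1) * A * R ^ d := by rw [Finset.sum_const, Finset.card_range, nsmul_eq_mul]; push_cast; ring

/-- The scaled polynomial `h_a(X) := scaleRoots h a` has `|coeff| ≤ A · a^d`. -/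
theorem abs_coeff_scaleRoots_le {h : Polynomial ℤ} {d : ℕ} (hd : h.natDegree ≤ d) {A : ℕ}
    (hA : ∀ i, |h.coeff i| ≤ (A : ℤ)) {a : ℕ} (ha : 1 ≤ a) (i : ℕ) :
    |(h.scaleRoots (a : ℤ)).coeff i| ≤ ((A * a ^ d : ℕ) : ℤ) := by
  rw [Polynomial.coeff_scaleRoots, abs_mul]
  push_cast
  refine mul_le_mul (hA i) ?_ (abs_nonneg _) (by positivity)
  rw [abs_pow, abs_of_nonneg (by positivity)]
  exact pow_le_pow_right₀ (by exact_mod_cast ha) (by omega)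

/-- The field `F_K = ℚ(θ_K) ⊂ ℝ`. -/
def FK (K : ℕ) : IntermediateField ℚ ℝ := ℚ⟮theta K⟯

/-- `θ_K` as an element of `F_K`. -/
def thetaF (K : ℕ) : FK K := ⟨theta K, IntermediateField.mem_adjoin_simple_self ℚ _⟩

/-- The field element `θ_K ∈ F_K` coerces to `θ_K`. -/
theorem thetaF_coe (K : ℕ) : ((thetaF K : FK K) : ℝ) = theta K := rfl

/-- `F_K = ℚ(θ_K)` is finite-dimensional over `ℚ`. -/
theorem finiteDimensional_FK (K : ℕ) : FiniteDimensional ℚ (FK K) :=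
  IntermediateField.adjoin.finiteDimensional (theta_isIntegral K)

/-- `[F_K : ℚ] = g_K`. -/
theorem finrank_FK (K : ℕ) : Module.finrank ℚ (FK K) = gdeg K := finrank_adjoin_theta K

/-- `θ_K ^ g_K = 2` in `F_K`. -/
theorem thetaF_pow (K : ℕ) : (thetaF K) ^ gdeg K = 2 := by
  apply Subtype.ext
  have h1 : (((thetaF K) ^ gdeg K : FK K) : ℝ) = theta K ^ gdeg K := by
    rw [SubmonoidClass.coe_pow, thetaF_coe]
  have h2 : (((2 : FK K)) : ℝ) = 2 := map_ofNat (algebraMap (FK K) ℝ) 2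
  rw [h1, theta_pow]; exact h2.symm

/-- `θ_K` is an algebraic INTEGER. -/
theorem thetaF_isIntegral (K : ℕ) : IsIntegral ℤ (thetaF K) := by
  refine IsIntegral.of_pow (gdeg_pos K) ?_
  rw [thetaF_pow]
  have : IsIntegral ℤ ((algebraMap ℤ (FK K)) 2) := isIntegral_algebraMap
  rwa [map_ofNat] at this

/-- The real embedding of `F_K` into `ℂ`, as a `ℚ`-algebra hom. -/
def sigma0 (K : ℕ) : FK K →ₐ[ℚ] ℂ :=
  { toRingHom := Complex.ofRealHom.comp (algebraMap (FK K) ℝ)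
    commutes' := fun q => by simp }

/-- The real embedding `σ₀` of `F_K` is the inclusion. -/
theorem sigma0_apply (K : ℕ) (y : FK K) : sigma0 K y = ((y : ℝ) : ℂ) := rfl

/-- Every embedding sends `θ_K` to a complex number of norm `≤ 2`. -/
theorem norm_emb_thetaF_le (K : ℕ) (σ : FK K →ₐ[ℚ] ℂ) : ‖σ (thetaF K)‖ ≤ 2 := by
  have h : ‖σ (thetaF K)‖ ^ gdeg K = 2 := by
    rw [← norm_pow, ← map_pow, thetaF_pow, map_ofNat, Complex.norm_two]
  refine le_of_pow_le_pow_left₀ (gdeg_ne_zero K) (by norm_num) ?_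
  rw [h]
  calc (2 : ℝ) = 2 ^ 1 := by norm_num
    _ ≤ 2 ^ gdeg K := pow_le_pow_right₀ (by norm_num) (gdeg_pos K)

/-- **THE LIOUVILLE INEQUALITY** at `β_K`: for `h ∈ ℤ[X]`, `h ≠ 0`, `deg h ≤ d < g_K`, `|h_i| ≤ A`:
`|h(β_K)| ≥ 1 / (a_K^d · M^{g_K})`, `M = (d+1) · A a_K^d · (2 a_K)^d`. -/
theorem liouville_betaSeq {K d A : ℕ} (hdg : d < gdeg K) {h : Polynomial ℤ} (hh : h ≠ 0)
    (hdeg : h.natDegree ≤ d) (hA : ∀ i, |h.coeff i| ≤ (A : ℤ)) :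
    1 / ((aN K : ℝ) ^ d * (((d : ℝ) + 1) * ((A * aN K ^ d : ℕ) : ℝ) * (2 * (aN K : ℝ)) ^ d) ^ gdeg K)
      ≤ |Polynomial.aeval (betaSeq K) h| := by
  classical
  haveI := finiteDimensional_FK K
  -- the scaled polynomial and the algebraic integer `y = a^{deg h} h(β)` inside `F_K`
  set ha : Polynomial ℤ := h.scaleRoots (aN K : ℤ) with hha
  set xF : FK K := ((Pseq K : ℕ) : FK K) + thetaF K with hxF
  set yF : FK K := Polynomial.aeval xF ha with hyF
  have hxR : ((xF : FK K) : ℝ) = (aN K : ℝ) * betaSeq K := by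
    rw [hxF, aN_mul_betaSeq]; push_cast; rw [thetaF_coe]
  -- `(yF : ℝ) = a^{deg h} · h(β)`
  have hyR : ((yF : FK K) : ℝ) = (aN K : ℝ) ^ h.natDegree * Polynomial.aeval (betaSeq K) h := by
    have e1 : ((yF : FK K) : ℝ) = Polynomial.aeval ((xF : FK K) : ℝ) ha := by
      rw [hyF]; exact ringHom_aeval_int (algebraMap (FK K) ℝ) xF ha
    rw [e1, hxR, hha, Polynomial.aeval_def, Polynomial.aeval_def,
      show (aN K : ℝ) = algebraMap ℤ ℝ (aN K : ℤ) by simp,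
      Polynomial.scaleRoots_eval₂_mul]
  -- `yF ≠ 0` by the degree certificate
  have hy0 : yF ≠ 0 := by
    intro h0
    have : ((yF : FK K) : ℝ) = 0 := by rw [h0]; rfl
    rw [hyR] at this
    rcases mul_eq_zero.mp this with h1 | h1
    · exact absurd h1 (pow_ne_zero _ (aNR_pos K).ne')
    · exact aeval_betaSeq_ne_zero hh (lt_of_le_of_lt hdeg hdg) h1
  -- `yF` is an algebraic integer
  have hPint : IsIntegral ℤ (((Pseq K : ℕ) : FK K)) := by
    have : (((Pseq K : ℕ) : ℤ) : FK K) = ((Pseq K : ℕ) : FK K) := by push_cast; rfl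
    rw [← this]; exact isIntegral_algebraMap
  have hyint : IsIntegral ℤ yF := by
    rw [hyF]; exact isIntegral_aeval_int (by rw [hxF]; exact hPint.add (thetaF_isIntegral K)) _
  -- its norm is a non-zero rational integer, hence `|N(yF)| ≥ 1`
  have hN0 : Algebra.norm ℚ yF ≠ 0 := Algebra.norm_ne_zero_iff.mpr hy0
  have hNint : IsIntegral ℤ (Algebra.norm ℚ yF) := Algebra.isIntegral_norm ℚ hyint
  obtain ⟨z, hz⟩ := IsIntegrallyClosed.isIntegral_iff.mp hNint
  have hz0 : z ≠ 0 := by rintro rfl; simp at hz; exact hN0 hz.symm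
  have hNnorm : 1 ≤ ‖algebraMap ℚ ℂ (Algebra.norm ℚ yF)‖ := by
    rw [← hz]
    simp only [eq_intCast, eq_ratCast, Rat.cast_intCast, Complex.norm_intCast]
    exact_mod_cast Int.one_le_abs hz0
  -- product over the embeddings
  rw [Algebra.norm_eq_prod_embeddings ℚ ℂ yF, norm_prod] at hNnorm
  have hcard : Fintype.card (FK K →ₐ[ℚ] ℂ) = gdeg K := by rw [AlgHom.card, finrank_FK]
  -- the bound `M` on every conjugate
  set M : ℝ := ((d : ℝ) + 1) * ((A * aN K ^ d : ℕ) : ℝ) * (2 * (aN K : ℝ)) ^ d with hM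
  have haN1 : 1 ≤ aN K := aN_pos K
  have hcoef : ∀ i, |ha.coeff i| ≤ ((A * aN K ^ d : ℕ) : ℤ) := abs_coeff_scaleRoots_le hdeg hA haN1
  have hdeg' : ha.natDegree ≤ d := by rw [hha, Polynomial.natDegree_scaleRoots]; exact hdeg
  have h1R : (1 : ℝ) ≤ aN K := by exact_mod_cast haN1
  have h1024 : (1024 : ℝ) ≤ aN K := by exact_mod_cast le_aN K
  have h2a : (1 : ℝ) ≤ 2 * (aN K : ℝ) := by linarith
  have hσ : ∀ σ : FK K →ₐ[ℚ] ℂ, ‖σ yF‖ ≤ M := by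
    intro σ
    have e : σ yF = Polynomial.aeval (σ xF) ha := by rw [hyF]; exact ringHom_aeval_int σ.toRingHom xF ha
    rw [e, hM]
    refine norm_aeval_le hdeg' hcoef h2a ?_
    rw [hxF, map_add, map_natCast]
    refine (norm_add_le _ _).trans ?_
    rw [Complex.norm_natCast]
    have := norm_emb_thetaF_le K σ
    have := Pseq_le K
    linarith
  -- `A ≥ 1` (else `h = 0`), hence `M ≥ 1`
  have hA1 : 1 ≤ A := by
    by_contra hlt
    have hA0 : (A : ℤ) = 0 := by exact_mod_cast (show A = 0 by omega)
    exact hh (Polynomial.ext fun i => by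
      have := hA i; rw [hA0] at this; rw [Polynomial.coeff_zero]; exact abs_nonpos_iff.mp this)
  have hM1 : 1 ≤ M := by
    rw [hM]
    have h3 : (1 : ℝ) ≤ ((A * aN K ^ d : ℕ) : ℝ) := by
      exact_mod_cast Nat.mul_le_mul hA1 (Nat.one_le_pow _ _ haN1)
    have h4 : (1 : ℝ) ≤ (2 * (aN K : ℝ)) ^ d := one_le_pow₀ h2a
    have h5 : (1 : ℝ) ≤ (d : ℝ) + 1 := by linarith [(Nat.cast_nonneg d : (0 : ℝ) ≤ d)]
    calc (1 : ℝ) = 1 * 1 * 1 := by ring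
      _ ≤ ((d : ℝ) + 1) * ((A * aN K ^ d : ℕ) : ℝ) * (2 * (aN K : ℝ)) ^ d :=
        mul_le_mul (mul_le_mul h5 h3 (by norm_num) (by positivity)) h4 (by norm_num) (by positivity)
  -- split off the real embedding `σ₀`
  have hsplit := Finset.mul_prod_erase (Finset.univ : Finset (FK K →ₐ[ℚ] ℂ)) (fun σ => ‖σ yF‖)
    (Finset.mem_univ (sigma0 K))
  rw [← hsplit] at hNnorm
  have hp0 : 0 ≤ ∏ σ ∈ (Finset.univ : Finset (FK K →ₐ[ℚ] ℂ)).erase (sigma0 K), ‖σ yF‖ :=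
    Finset.prod_nonneg fun σ _ => norm_nonneg _
  have hrest : ∏ σ ∈ (Finset.univ : Finset (FK K →ₐ[ℚ] ℂ)).erase (sigma0 K), ‖σ yF‖ ≤ M ^ gdeg K := by
    calc ∏ σ ∈ (Finset.univ : Finset (FK K →ₐ[ℚ] ℂ)).erase (sigma0 K), ‖σ yF‖
        ≤ ∏ σ ∈ (Finset.univ : Finset (FK K →ₐ[ℚ] ℂ)).erase (sigma0 K), M :=
          Finset.prod_le_prod (fun σ _ => norm_nonneg _) (fun σ _ => hσ σ)
      _ = M ^ (gdeg K - 1) := by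
          rw [Finset.prod_const, Finset.card_erase_of_mem (Finset.mem_univ _), Finset.card_univ, hcard]
      _ ≤ M ^ gdeg K := pow_le_pow_right₀ hM1 (Nat.sub_le _ _)
  -- `‖σ₀ yF‖ = a^{deg h} |h(β)| ≤ a^d |h(β)|`
  have hσ0 : ‖sigma0 K yF‖ = (aN K : ℝ) ^ h.natDegree * |Polynomial.aeval (betaSeq K) h| := by
    rw [sigma0_apply, Complex.norm_real, Real.norm_eq_abs, hyR, abs_mul, abs_pow,
      abs_of_pos (aNR_pos K)]
  have hσ0' : ‖sigma0 K yF‖ ≤ (aN K : ℝ) ^ d * |Polynomial.aeval (betaSeq K) h| := by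
    rw [hσ0]
    exact mul_le_mul_of_nonneg_right (pow_le_pow_right₀ h1R hdeg) (abs_nonneg _)
  -- assemble: `1 ≤ a^d |h(β)| M^g`
  have hhb : 0 < |Polynomial.aeval (betaSeq K) h| :=
    abs_pos.mpr (aeval_betaSeq_ne_zero hh (lt_of_le_of_lt hdeg hdg))
  have hmain : (1 : ℝ) ≤ (aN K : ℝ) ^ d * M ^ gdeg K * |Polynomial.aeval (betaSeq K) h| := by
    calc (1 : ℝ) ≤ ‖(sigma0 K) yF‖ * ∏ σ ∈ Finset.univ.erase (sigma0 K), ‖σ yF‖ := hNnorm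
      _ ≤ ((aN K : ℝ) ^ d * |Polynomial.aeval (betaSeq K) h|) * M ^ gdeg K :=
          mul_le_mul hσ0' hrest hp0 (by positivity)
      _ = (aN K : ℝ) ^ d * M ^ gdeg K * |Polynomial.aeval (betaSeq K) h| := by ring
  have hden : (0 : ℝ) < (aN K : ℝ) ^ d * M ^ gdeg K := by
    have := aNR_pos K; positivity
  rw [one_div_le hden hhb, one_div, inv_le_iff_one_le_mul₀ hhb]
  linarith [hmain]

end Member

end Summit.Schanuel.Schanuel.Theorems.RootDecomp1BAlgFrame

end
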